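import Summits.NavierStokesRegularity.NavierStokesRegularity.Theorems.StrainDoorsNearRecordSecondOrderDeficit
import HarnessLib

/-!
# StrainDoorsNearRecordSecondOrderRate — PART M §M8–§M9: THE SECOND-ORDER NEAR-RECORD LAWS WITH THE RATE `δ^{1/3}`

(Tree file 3 of 3 of PART M (§M8/§M9, ROUND 63 text C); text of nsreg-p1 r63/StrainDoorsNearRecordSecondOrderRate.lean sha256 97e6be56218c081e, split at the 400-line cap at § boundaries,
bodies verbatim; imports file 2 `StrainDoorsNearRecordSecondOrderDeficit`.)

nsreg-p1 g36, ROUND-63 (helper lane of `stmt-NavierStokesRegularity-0056`, rung N0; 0 ledger writes by the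
planner — text for the S-lane, `--supports stmt-NavierStokesRegularity-0056 --as helper`; tree file 3 of 5 of
ROUND-63, independent of files 1–2; bodies farm-certified inside `r63/StrainDoorsR63All.lean`, rc 0 · 0 warn ·
0 sorry, std axioms).

§M8 (the `k = 4` KNSS window): `window_transfer_D4`, `exists_uniform_D4Bound` (`‖D⁴u(t,·)‖ ≤ K₄(C₀)` for
`t ≤ −1/4` in the classical Type-I class on `(−∞,0) × ℝ³`), `exists_uniform_D3Lipschitz` (`‖D³u‖ ≤ K₃`,
`‖D³u(t,x) − D³u(t,y)‖ ≤ K₄|x − y|`).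

§M9 (the laws): at a near-record of `|ω'|²` at time `−1` the symmetric second difference along a unit direction
`e` is `≤ 2(W² − |ω'(z)|²) ≤ 4Wδ`, and `∂_e∂_e|ω'|²` is Lipschitz along lines by §M8; the cubic symmetric Taylor
estimate gives `∂_e∂_e|ω'|²(z)·s² ≤ 4Wδ + 2K s³` for all `s > 0`, whence the RATE `δ^{1/3}`:
* `cube_le_of_forall_sq_le`, `abs_symm_second_difference_sub_le`, `second_deriv_cube_le_of_le` — Fermat at a
  near-maximum, SECOND ORDER, with a rate (one real variable);
* `fderiv_curl_nsRescale`, `fderiv_fderiv_curl_apply_nsRescale` — scale laws of `∇ω` (`λ³`) and `∂_e∂_e ω` (`λ⁴`);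
* ★★★ `typeI_vorticity_secondOrder_deficit` — `[(0 − t)³ (|∂_e ω|² + ⟪ω, ∂_e∂_e ω⟫)(t,x)]³ ≤ A(C₀)·W·δ` for
  every unit `e`, whenever `(0 − t)|ω(t,·)| ≤ W` at that instant and `(0 − t)|ω(t,x)| ≥ W − δ`;
* ★★ `typeI_vorticity_laplacian_deficit` — summed over a frame:
  `[(0 − t)³ (|∇ω|²_F + ⟪ω, Δω⟫)(t,x)]³ ≤ 27A·W·δ` (`½Δ|ω|² = |∇ω|²_F + ⟪ω,Δω⟫`);
* `typeI_vorticity_laplacian_nonpos_at_max` — sanity (`δ = 0`): the classical `Δ|ω|² ≤ 0` at a maximum.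

WHAT THIS IS NOT: necessary conditions at near-record points; nothing here excludes a blow-up; `0056` / `10661` /
NS regularity are NOT proved; the peak doors of PART K stay OPEN.  No new definitions; no sorry.
[cite: KochNadirashviliSereginSverak2009, §2 p. 5, §4 (4.11); ChaeWolf2017RemovingDSS, §3 Step 2;
ConstantinFefferman1993, §1]
-/

noncomputable section

open MeasureTheory Set Function Filter Metric Real InnerProductSpace
open _root_.Topology
open scoped ENNReal NNReal RealInnerProductSpace ContDiff Laplacian
open Literature.Analysis Literature.Analysis.FluidPDE
open Literature.Analysis.FluidPDE.VorticityDirectionDynamics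

set_option linter.dupNamespace false
set_option maxSynthPendingDepth 3

namespace Summit.NavierStokesRegularity.NavierStokesRegularity.Theorems.StrainDoors

open Summit.NavierStokesRegularity.NavierStokesRegularity.Theorems.ArgmaxDoors

/-- Real-variable lemma: three numbers with cubes `≤ R` (`R ≥ 0`) have `(c₀ + c₁ + c₂)³ ≤ 27 R`. [folklore] -/
theorem add_add_pow_three_le {c₀ c₁ c₂ R : ℝ} (hR : 0 ≤ R) (h₀ : c₀ ^ 3 ≤ R) (h₁ : c₁ ^ 3 ≤ R)
    (h₂ : c₂ ^ 3 ≤ R) : (c₀ + c₁ + c₂) ^ 3 ≤ 27 * R := by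
  rcases le_or_gt (c₀ + c₁ + c₂) 0 with hs | hs
  · exact (Odd.pow_nonpos (⟨1, by norm_num⟩ : Odd 3) hs).trans (by positivity)
  obtain ⟨m, hm⟩ : ∃ m : ℝ, m = max c₀ (max c₁ c₂) := ⟨_, rfl⟩
  have hm3 : m ^ 3 ≤ R := by
    rcases max_choice c₀ (max c₁ c₂) with h | h <;> rw [h] at hm
    · rw [hm]; exact h₀
    · rcases max_choice c₁ c₂ with h' | h' <;> rw [h'] at hm <;> rw [hm]
      · exact h₁
      · exact h₂
  have hsm : c₀ + c₁ + c₂ ≤ 3 * m := by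
    have e0 : c₀ ≤ m := hm ▸ le_max_left _ _
    have e1 : c₁ ≤ m := hm ▸ (le_max_left _ _).trans (le_max_right _ _)
    have e2 : c₂ ≤ m := hm ▸ (le_max_right _ _).trans (le_max_right _ _)
    linarith
  calc (c₀ + c₁ + c₂) ^ 3 ≤ (3 * m) ^ 3 := pow_le_pow_left₀ hs.le hsm 3
    _ = 27 * m ^ 3 := by ring
    _ ≤ 27 * R := by linarith

/-- ★★ **THE NEAR-RECORD LAPLACIAN LAW WITH THE RATE `δ^{1/3}`.**  Summing the second-order law over an
orthonormal frame: there is `A = A(C₀) ≥ 0` with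
`[(0 − t)³ · ( |∇ω(t,x)|²_F + ⟪ω(t,x), Δω(t,x)⟫ )]³ ≤ A · W · δ`
at every point where the scale-invariant vorticity of a classical Type-I solution is within `δ` of a bound
`W` of the scale-invariant vorticity at that instant (`½Δ|ω|² = |∇ω|² + ⟪ω,Δω⟫`).  Consequences (memo): with
`|∇ω|² = ρ²|∇ξ|²_F + |∇ρ|²` this is the QUANTITATIVE form of the peak inequality `⟪ξ̄, Δω̄⟫ ≤ −ρ̄|∇ξ̄|²_F`
(PART K) on `u` itself, `(0−t)²⟪ξ, Δω⟫ + (0−t)²ρ|∇ξ|²_F + (0−t)³|∇ρ|²/((0−t)ρ) ≤ (A W δ)^{1/3}/((0−t)ρ)`,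
and hence the twist pinch of ROUND 62 with the explicit rate `δ^{1/3}`. [new-as-typed] -/
theorem typeI_vorticity_laplacian_deficit {C₀ : ℝ} (hC₀ : 0 ≤ C₀) :
    ∃ A : ℝ, 0 ≤ A ∧
      ∀ (u : ℝ → (EuclideanSpace ℝ (Fin 3)) → (EuclideanSpace ℝ (Fin 3))) (p : ℝ → (EuclideanSpace ℝ (Fin 3)) → ℝ)
        (W t δ : ℝ) (x : EuclideanSpace ℝ (Fin 3)),
        IsClassicalNSSolutionOn (Iio 0) 1 0 u p → HasTypeIDecay C₀ u → t < 0 →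
        (∀ y, (0 - t) * ‖curl (u t) y‖ ≤ W) → 0 ≤ δ → W - δ ≤ (0 - t) * ‖curl (u t) x‖ →
        ((0 - t) ^ 3 * (frobeniusNormSq (fderiv ℝ (curl (u t)) x) +
            ⟪curl (u t) x, (Δ (curl (u t))) x⟫)) ^ 3 ≤ A * W * δ := by
  obtain ⟨A, hA, hlaw⟩ := typeI_vorticity_secondOrder_deficit hC₀
  refine ⟨27 * A, by positivity, fun u p W t δ x hsol hI ht hdom hδ hnear => ?_⟩
  have htI : t ∈ Iio (0 : ℝ) := ht
  obtain ⟨b, hb⟩ : ∃ b : OrthonormalBasis (Fin 3) ℝ (EuclideanSpace ℝ (Fin 3)),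
      b = EuclideanSpace.basisFun (Fin 3) ℝ := ⟨_, rfl⟩
  have hb1 : ∀ i, ‖b i‖ = 1 := fun i => b.orthonormal.1 i
  -- smoothness of `ω(t,·)` and the identification of the second directional derivatives
  have hω : ContDiff ℝ ∞ (curl (u t)) :=
    contDiff_curl (n := ⊤) ((hsol.contDiff_velocity htI).of_le (by exact_mod_cast (le_top : (⊤ + 1 : ℕ∞) ≤ ⊤)))
  have hdd : DifferentiableAt ℝ (fderiv ℝ (curl (u t))) x :=
    ((hω.fderiv_right (m := 1) (by norm_cast)).differentiable (by norm_cast)) x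
  have hdir : ∀ e : EuclideanSpace ℝ (Fin 3), fderiv ℝ (fun y => fderiv ℝ (curl (u t)) y e) x e =
      fderiv ℝ (fderiv ℝ (curl (u t))) x e e := fun e => by
    rw [fderiv_clm_apply hdd (differentiableAt_const e), fderiv_fun_const]
    simp
  have hlap : ⟪curl (u t) x, (Δ (curl (u t))) x⟫ =
      ∑ i, ⟪curl (u t) x, fderiv ℝ (fun y => fderiv ℝ (curl (u t)) y (b i)) x (b i)⟫ := by
    rw [laplacian_eq_iteratedFDeriv_orthonormalBasis (curl (u t)) b, inner_sum]
    refine Finset.sum_congr rfl fun i _ => ?_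
    rw [iteratedFDeriv_two_apply, hdir]
    simp
  have hfrob : frobeniusNormSq (fderiv ℝ (curl (u t)) x) = ∑ i, ‖fderiv ℝ (curl (u t)) x (b i)‖ ^ 2 :=
    frobeniusNormSq_eq_sum b _
  -- the three directional laws
  have hc : ∀ i, ((0 - t) ^ 3 * (‖fderiv ℝ (curl (u t)) x (b i)‖ ^ 2 +
      ⟪curl (u t) x, fderiv ℝ (fun y => fderiv ℝ (curl (u t)) y (b i)) x (b i)⟫)) ^ 3 ≤ A * W * δ :=
    fun i => hlaw u p W t δ x (b i) hsol hI ht hdom hδ hnear (hb1 i)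
  have hsum : (0 - t) ^ 3 * (frobeniusNormSq (fderiv ℝ (curl (u t)) x) + ⟪curl (u t) x, (Δ (curl (u t))) x⟫) =
      ∑ i, (0 - t) ^ 3 * (‖fderiv ℝ (curl (u t)) x (b i)‖ ^ 2 +
        ⟪curl (u t) x, fderiv ℝ (fun y => fderiv ℝ (curl (u t)) y (b i)) x (b i)⟫) := by
    rw [hfrob, hlap, ← Finset.sum_add_distrib, Finset.mul_sum]
  have hW0 : 0 ≤ W := by
    have h := hdom x
    have : 0 ≤ (0 - t) * ‖curl (u t) x‖ := mul_nonneg (by linarith) (norm_nonneg _)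
    linarith
  rw [hsum, Fin.sum_univ_three, show 27 * A * W * δ = 27 * (A * W * δ) by ring]
  exact add_add_pow_three_le (by positivity) (hc 0) (hc 1) (hc 2)

/-- Sanity corollary (`δ = 0`): at an exact spatial maximum `x` of `|ω(t,·)|` of a classical Type-I solution the
law is the classical second-order condition `|∇ω|²_F + ⟪ω, Δω⟫ = ½Δ|ω|² ≤ 0` at `(t,x)` — the rate law
interpolates it. [folklore; routed through the law as a statement check] -/
theorem typeI_vorticity_laplacian_nonpos_at_max {C₀ : ℝ} (hC₀ : 0 ≤ C₀)
    {u : ℝ → (EuclideanSpace ℝ (Fin 3)) → (EuclideanSpace ℝ (Fin 3))} {p : ℝ → (EuclideanSpace ℝ (Fin 3)) → ℝ}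
    (hsol : IsClassicalNSSolutionOn (Iio 0) 1 0 u p) (hI : HasTypeIDecay C₀ u) {t : ℝ} (ht : t < 0)
    {x : EuclideanSpace ℝ (Fin 3)} (hmax : ∀ y, ‖curl (u t) y‖ ≤ ‖curl (u t) x‖) :
    frobeniusNormSq (fderiv ℝ (curl (u t)) x) + ⟪curl (u t) x, (Δ (curl (u t))) x⟫ ≤ 0 := by
  obtain ⟨A, -, h⟩ := typeI_vorticity_laplacian_deficit hC₀
  have h1 := h u p ((0 - t) * ‖curl (u t) x‖) t 0 x hsol hI ht
    (fun y => mul_le_mul_of_nonneg_left (hmax y) (by linarith)) le_rfl (by linarith)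
  rw [mul_zero] at h1
  by_contra hq
  have hq' : 0 < frobeniusNormSq (fderiv ℝ (curl (u t)) x) + ⟪curl (u t) x, (Δ (curl (u t))) x⟫ :=
    lt_of_not_ge hq
  have ht3 : 0 < (0 - t) ^ 3 := pow_pos (by linarith) 3
  have h2 : 0 < (0 - t) ^ 3 * (frobeniusNormSq (fderiv ℝ (curl (u t)) x) +
      ⟪curl (u t) x, (Δ (curl (u t))) x⟫) := mul_pos ht3 hq'
  linarith [pow_pos h2 3]

end Summit.NavierStokesRegularity.NavierStokesRegularity.Theorems.StrainDoors

end
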